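import Literature.NumberTheory.Rogawski1990.CurveThetaHodgeTypeSigned
import HarnessLib

/-!
# [Liu2021, Rem. D.5] — the NECESSITY HALF of the signed Hodge-type rule for theta finite components on the unitary Shimura CURVES («OCCURS ⇒ SIGN»):
# a `(1,0)`-type [resp. `(0,1)`-type] occurrence of `ω(λ, ε_a, χ)_f` with `ε_a` λ-ADMISSIBLE forces `e♮ ∈ Φ_λ` [resp. `e♮ ∉ Φ_λ`] — the one-directional
# twins E3nec₂ of ★ `curveThetaHodgeTypeSigned_hol ∕ _antihol` (E3₂, ★ `CurveThetaHodgeTypeSigned`)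

Topic `NumberTheory/Rogawski1990`; namespace `Literature.NumberTheory.Rogawski1990`.  Two closed named facts `def … : Prop` (no `sorry`, no instance, no
notation, no new carrier) + two DOMINANCE theorems `…_of_signed` (each letter IS the restriction of the stronger ★ E3₂ biconditional, proved next to it —
reviewer rule 5b).  HONEST DEBT: +2 named facts that REPLACE, in the books of the floor-0 programme P5 (`Cruxes/HLiu418/Lines/F0_AlbCm`,
packaged stub `stub_S1b_facts`; `Lines/F0_AlbCmS1bHodge`, `stub_E3hol`), the STRONGER biconditional letters E3₂ ★ `curveThetaHodgeTypeSigned_hol ∕ _antihol`: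
the P5 kernel chain consumes, at every call site, ONLY the direction «occurrence ∧ admissible ⇒ sign of `e♮`» (census F0P5-p02 (g4)
`F0/P5/p02/CENSUS-E3-direction.v1`, F0P5-plan (g2) desk word #11, 2026-08-31): ★ `Theorems/F0AlbCmS1bSignedExclusion` :319–323 uses `key.2 hadm'` (hol: adm → `e♮ ∈ Φ_λ`) and
:358–362 uses `key.1 hh hadm'` (antihol: `e♮ ∈ Φ_λ` → ¬adm), both under `hadm'` (the admissibility of `ε_a`, which the crux binder `_hadm` supplies); ★
`Theorems/HLiu418S1BettiSliceExclusionSigned` :227–232 uses the two biconditionals only for their CONSISTENCY and re-feeds to the same two halves.  The EXISTENCE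
half «sign ⇒ occurs» (non-vanishing of the global theta lift, Liu's «`m = 1`») is never consumed and is NOT asserted here.  `Signed_hol → Necessity_hol`,
`Signed_antihol → Necessity_antihol` are restrictions; `Necessity_antihol` follows from `Necessity_hol` by complex conjugation and the conjugate partner of the
oscillator carrier (★ `Summits/…/Theorems/HLiu418ChiSplittingMirror.exists_conjPartner_omegaAtLine_neg`, ★ `…E3AntiholOfHol.exists_isAdmissibleElement_bar_locF_neg_iff`).

SETTING AND TOKENS = those of ★ `CurveThetaHodgeTypeSigned.lean` VERBATIM (imported): binder prefix of the crux letter `S1BettiShape` (`L` CM with `[L:ℚ] ≥ 4`, `ι`,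
`H ∈ M₂(L)` with `formCongr c g (t • H) = diag dV`, signature `(1,1)` at `ι` and definite elsewhere, cone frame `𝔣`, automorphic `μ`), the ω-side data (reindexing `e₁`,
the LABEL `λ` conjugate symplectic OF WEIGHT ONE with CM type `Φ_λ := hλ.cmType`, line `a ∈ (L⁺)ˣ`, character `χ`), an IRREDUCIBLE SMOOTH `σ` with an INJECTIVE
intertwiner `j : σ → ω(λ, ε_a, χ)_f ∘ (finAdelicCongr … g ht hg).symm` (the crux's `ω⋆_lab` term at `λ := galConj c μ`, `a := r.toFun ε`, `e₁ := finProdFinEquiv`,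
`j := id`), Hodge types `IsHolCotangentAt₂ ∕ IsAntiholCotangentAt₂`, `HasFinComponent`, `e♮ := (cmPlace L ι).1.embedding` (THE embedding defining the complex
structure of the cone carriers, print's `τ′₁`), and λ-ADMISSIBILITY of `ε_a` in the tree's direct form of [Liu2021, Def. 4.12]:
`∃ e, IsAdmissibleElement L Φ_λ e ∧ epsOf L⁺ (imagUnitSq L) L (2·imagUnit L)⁻¹ e = locF L⁺ (imagUnitSq L) a` (the right-hand side of the E3₂ biconditional, verbatim).

THE LETTERS (CLASS **U** — readings of a printed statement; chain in each docstring):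
* `curveThetaHodgeTypeNecessity_hol` (E3nec₂, Hodge type `(1,0)`): a `(1,0)`-type occurrence of `σ ↪ ω(λ, ε_a, χ)_f` with `ε_a` λ-admissible FORCES `e♮ ∈ Φ_λ`.
* `curveThetaHodgeTypeNecessity_antihol` (E3nec₂, Hodge type `(0,1)`): a `(0,1)`-type occurrence with `ε_a` λ-admissible FORCES `e♮ ∉ Φ_λ`.
READING.  [Liu2021, Rem. D.5] (FJcycle.tex l. 5396–5405, p. 131): «for `π^∞ ≃ ω(μ,ε,χ)` endoscopic cohomological, `m_cusp(π^{(1,0)}_∞ ⊗ π^∞) = 1` (resp.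
`m_cusp(π^{(0,1)}_∞ ⊗ π^∞) = 1`) if and only if there exists some `e ∈ E^{×−}` such that `ε_v = e Nm E_v^×` for every nonarchimedean `v`, `τ′_i(e)` has negative
imaginary part for `i ≥ 2`, and `τ′_1(e)` has negative (resp. positive) imaginary part» — of which these letters are the «ONLY IF» (necessity) halves, read at
`τ′₁ := e♮` in the label-generic form of ★ `CurveThetaHodgeTypeSigned` (relabelling [Liu2021, Lem. D.1 (4)]; Hilbert reciprocity ★ `even_ncard_not_isIsotropic_add_finrank_sub_one`,
★ `isAdmissible_epsOf_iff_even_card`): IF `π^{(1,0)}_∞ ⊗ ω(λ, ε_a, χ)_f` occurs in `L²_disc(U(H))` and `ε_a` IS λ-admissible, then `e♮ ∈ Φ_λ` (the `(0,1)`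
occurrence excludes it).  In Liu's proof (p. 130–131) this is the multiplicity formula `m(π) = ½(1 + ∏_v ε_v(π_v))` of [Rogawski1990, Prop. 11.2.1 (b),
Prop. 11.1.1 (b),(d)] ([LabesseLanglands1979]) transported by [Harris1993]: an automorphic member of the endoscopic packet has `∏_v ε_v = +1`, and the two
archimedean members `π^{(1,0)}`, `π^{(0,1)}` carry opposite signs; in theta language it is the LOCAL THETA DICHOTOMY [HarrisKudlaSweet1996, Thm. 6.1] with the
COHERENCE of the hermitian line from which an automorphic `π` with theta local components is lifted (Rallis inner product formula for `θ(π) ≠ 0`) — NO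
construction of automorphic forms (the «IF» ∕ existence half, non-vanishing of the global theta lift of `λ`) is part of these letters.
WHY IT MIGHT FAIL: only through the orientation conventions (`e♮` vs `ι`, the sign of `δ_L`, `Φ_λ` vs `Φ̄_λ`) — the same 🟧 bit as the E3₂ letters, from which
these follow by restriction.  Cell `hodgecm-mathlib`, floor-0 programme P5, seat F0P5-p02 (g4).  HC_CM is proved only modulo the printed citations until rung 0
closes; this file discharges none of them.

## References
* [Liu2021] Y. Liu, *Fourier–Jacobi cycles and arithmetic relative trace formula*, Camb. J. Math. 9 (2021) = arXiv:2102.11518: Rem. D.5 (p. 131; held chunk p0059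
  L5–L12), Prop. D.4 (1) and its proof (p. 130–131), Lem. D.1 (2), (4), Lem. D.2 (3), Def. 4.12, proof of Thm. D.6 (1).
* [Rogawski1990] J. Rogawski, *Automorphic representations of unitary groups in three variables*, Ann. of Math. Stud. 123 (1990), Ch. 11 (held chunks p0152–p0158):
  Prop. 11.1.1 (b), (d); Prop. 11.2.1 (b); Thm. 11.5.1 (b).
* [HarrisKudlaSweet1996] M. Harris, S. Kudla, W. J. Sweet, *Theta dichotomy for unitary groups*, J. AMS 9 (1996), Thm. 6.1.
* [LabesseLanglands1979] J.-P. Labesse, R. P. Langlands, Canad. J. Math. 31 (1979).  [Harris1993] M. Harris, J. AMS 6 (1993).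
-/

noncomputable section

open NumberField NumberField.InfinitePlace MeasureTheory IsDedekindDomain
open scoped Matrix ComplexOrder

namespace Literature.NumberTheory.Rogawski1990

open Literature.NumberTheory.Automorphic Literature.NumberTheory.Automorphic.UnitaryGroup
open Literature.NumberTheory.Automorphic.UnitaryCurveForms
open Literature.NumberTheory.Automorphic.Liu2021 Literature.NumberTheory.Automorphic.Liu2021.Def411WeilCarriers
open Literature.NumberTheory.Automorphic.Liu2021.Def411WeilCarriersDoubling
open Literature.NumberTheory.GaloisRepresentations Literature.NumberTheory.Automorphic.IdeleClassGroup
open Literature.AlgebraicGeometry.Liu2021 (IsAdmissibleElement)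
open Literature.NumberTheory.GelbartRogawski1991 Literature.NumberTheory.GelbartRogawski1991.UnitaryDualPair
open Literature.RepresentationTheory.Liu2021 Literature.RepresentationTheory.HarrisKudlaSweet1996

/-- **U** (E3nec₂, Hodge type `(1,0)`) **[Liu2021, Rem. D.5], NECESSITY half («only if»), holomorphic occurrence: a `(1,0)`-TYPE OCCURRENCE OF `ω(λ, ε_a, χ)_f` WITH
`ε_a` λ-ADMISSIBLE FORCES `e♮ ∈ Φ_λ`**, `e♮ := (cmPlace L ι).1.embedding`.  Setting, ω-side data and tokens = ★ `curveThetaHodgeTypeSigned_hol` VERBATIM (`λ` conjugate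
symplectic of weight one, `σ` irreducible smooth with an injective `j : σ → ω(λ, ε_a, χ)_f ∘ (finAdelicCongr …)⁻¹`, `P` discrete of Hodge type `(1,0)` at `ι` with finite
component `σ`); conclusion: admissibility (`∃ e, IsAdmissibleElement L Φ_λ e ∧ ε(e) = ε_a`, [Liu2021, Def. 4.12]) IMPLIES `e♮ ∈ Φ_λ` — the direction «adm → `e♮ ∈ Φ_λ`»
of the E3₂ biconditional, the only one the crux `HLiu418` consumes (★ `F0AlbCmS1bSignedExclusion` :322 `key.2 hadm'`).  READING: [Liu2021, Rem. D.5] «`m_cusp(π^{(1,0)}_∞ ⊗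
ω(μ,ε,χ)) = 1` only if some `e ∈ E^{×−}` with collection `ε` is negative at `Φ_μ ∖ {τ′₁}` and NEGATIVE at `τ′₁`» (multiplicity formula [Rogawski1990, Prop. 11.2.1 (b),
Prop. 11.1.1 (b), (d)] after [Harris1993]; theta language: dichotomy [HarrisKudlaSweet1996, Thm. 6.1] + coherence), label-generic via [Liu2021, Lem. D.1 (4)].
Restriction of ★ `curveThetaHodgeTypeSigned_hol`. [cite: Liu2021, App. D Rem. D.5 (p. 131); Prop. D.4 (1) and its proof (p. 130–131); Lem. D.1 (4); Def. 4.12]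
[cite: Rogawski1990, §11.1 Prop. 11.1.1 (b), (d); Prop. 11.2.1 (b); Thm. 11.5.1 (b)] [cite: HarrisKudlaSweet1996, Thm. 6.1] -/
def curveThetaHodgeTypeNecessity_hol : Prop :=
  ∀ (L : Type) [Field L] [NumberField L] [IsCMField L] (ι : L →+* ℂ) (H : Matrix (Fin 2) (Fin 2) L)
    (dV : Fin 2 → L) (hdV : ∀ i, IsCMField.complexConj L (dV i) = dV i) (hdV0 : ∀ i, dV i ≠ 0)
    (t : L) (ht : t ≠ 0) (g : GL (Fin 2) L)
    (hg : formCongr ((IsCMField.complexConj L : L ≃ₐ[↥(maximalRealSubfield L)] L) : L →+* L) g (t • H) = Matrix.diagonal dV),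
    (∃ T : GL (Fin 2) ℂ, formCongr (starRingEnd ℂ) T ((Matrix.diagonal dV).map ι) = Matrix.diagonal ![(1 : ℂ), -1]) →
    (∀ τ' : L →+* ℂ, InfinitePlace.mk τ' ≠ InfinitePlace.mk ι → ((Matrix.diagonal dV).map τ').PosDef) →
    4 ≤ Module.finrank ℚ L →
    ∀ (𝔣 : ConeFrame L H (cmPlace L ι))
      (μ : Measure (adelicGroupData (↥(maximalRealSubfield L)) L (IsCMField.complexConj L) 2 H).automorphicQuotient)
      [(adelicGroupData (↥(maximalRealSubfield L)) L (IsCMField.complexConj L) 2 H).IsAutomorphicMeasure μ]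
      -- the ω-side data: reindexing, the LABEL `λ` (conjugate symplectic, weight one), line, central character
      {n' : ℕ} (e₁ : Fin 2 × Fin 1 ≃ Fin n')
      (lam : Literature.NumberTheory.Automorphic.IdeleClassGroup L →ₜ* Circle) (hlam : IsConjugateSymplectic L lam), HasWeight L lam 1 →
    ∀ (a : (↥(maximalRealSubfield L))ˣ) (χ : Chi (↥(maximalRealSubfield L)) L (IsCMField.complexConj L))
      (W : Type) [AddCommGroup W] [Module ℂ W]
      (σ : Representation ℂ (finAdelic (↥(maximalRealSubfield L)) L (IsCMField.complexConj L) 2 H) W),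
      σ.IsIrreducible → σ.IsSmooth →
    ∀ j : σ.IntertwiningMap
        ((rhoVAtLine (↥(maximalRealSubfield L)) L (IsCMField.complexConj L) 2 e₁ (Matrix.diagonal dV)
            (complexConj_imagUnit L) (imagUnit_ne_zero L) (imagUnit_mul_self L) (realDiagonal_isSymm L dV hdV)
            (isUnit_det_realDiagonal L dV hdV hdV0) (realDiagonal_map L dV hdV).symm
            (fun a => isCompatible_chiSplittingLine L e₁ dV hdV hdV0 (toHeckeCharacter L lam)
              (isUnitary_toHeckeCharacter L lam) ((isOscillatorChar_toHeckeCharacter_iff lam).mpr hlam)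
              (TW (↥(maximalRealSubfield L)) a) (isSymm_TW (↥(maximalRealSubfield L)) a)
              (isUnit_det_TW (↥(maximalRealSubfield L)) a) (JW (↥(maximalRealSubfield L)) L a)
              (JW_eq (↥(maximalRealSubfield L)) L a)) a χ).comp
          (finAdelicCongr (↥(maximalRealSubfield L)) L (IsCMField.complexConj L) g ht hg).symm.toMonoidHom),
      Function.Injective j →
    ∀ P : DiscreteAutomorphicRep (adelicGroupData (↥(maximalRealSubfield L)) L (IsCMField.complexConj L) 2 H) μ,
      P.IsHolCotangentAt₂ (IsCMField.complexConj_ne_one L) (UnitaryGroup.complexConj_smul_infinitePlace L) (cmPlace L ι) 𝔣 →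
      P.HasFinComponent σ →
      (∃ e : L, IsAdmissibleElement L hlam.cmType.1 e ∧
          epsOf (↥(maximalRealSubfield L)) (imagUnitSq L) L (2 * imagUnit L)⁻¹ e = locF (↥(maximalRealSubfield L)) (imagUnitSq L) a) →
      (cmPlace L ι).1.embedding ∈ hlam.cmType.1

/-- **U** (E3nec₂, Hodge type `(0,1)`) **[Liu2021, Rem. D.5], NECESSITY half, antiholomorphic occurrence: a `(0,1)`-TYPE OCCURRENCE OF `ω(λ, ε_a, χ)_f` WITH `ε_a`
λ-ADMISSIBLE FORCES `e♮ ∉ Φ_λ`** — the statement of `curveThetaHodgeTypeNecessity_hol` with `IsAntiholCotangentAt₂` and the negated conclusion; the direction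
«`e♮ ∈ Φ_λ` → ¬adm» of ★ `curveThetaHodgeTypeSigned_antihol`, the only one the crux consumes (★ `F0AlbCmS1bSignedExclusion` :361 `key.1 hh hadm'`); same reading
(«resp. POSITIVE at `τ′₁`»: an admissible `ε_a` excludes the `(0,1)` occurrence when `e♮ ∈ Φ_λ`).  Follows from `_hol` by complex conjugation and the conjugate
partner `ω(λᶜ, ⟨−a⟩, χ̄)` ([Liu2021, Lem. D.1 (2)], ★ `exists_conjPartner_omegaAtLine_neg`) with the admissibility flip [Liu2021, Def. 4.12, last sentence].
[cite: Liu2021, App. D Rem. D.5 (p. 131); Prop. D.4 (1) and its proof (p. 130–131); Lem. D.1 (2), (4); Def. 4.12]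
[cite: Rogawski1990, §11.1 Prop. 11.1.1 (b), (d); Prop. 11.2.1 (b); Thm. 11.5.1 (b)] [cite: HarrisKudlaSweet1996, Thm. 6.1] -/
def curveThetaHodgeTypeNecessity_antihol : Prop :=
  ∀ (L : Type) [Field L] [NumberField L] [IsCMField L] (ι : L →+* ℂ) (H : Matrix (Fin 2) (Fin 2) L)
    (dV : Fin 2 → L) (hdV : ∀ i, IsCMField.complexConj L (dV i) = dV i) (hdV0 : ∀ i, dV i ≠ 0)
    (t : L) (ht : t ≠ 0) (g : GL (Fin 2) L)
    (hg : formCongr ((IsCMField.complexConj L : L ≃ₐ[↥(maximalRealSubfield L)] L) : L →+* L) g (t • H) = Matrix.diagonal dV),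
    (∃ T : GL (Fin 2) ℂ, formCongr (starRingEnd ℂ) T ((Matrix.diagonal dV).map ι) = Matrix.diagonal ![(1 : ℂ), -1]) →
    (∀ τ' : L →+* ℂ, InfinitePlace.mk τ' ≠ InfinitePlace.mk ι → ((Matrix.diagonal dV).map τ').PosDef) →
    4 ≤ Module.finrank ℚ L →
    ∀ (𝔣 : ConeFrame L H (cmPlace L ι))
      (μ : Measure (adelicGroupData (↥(maximalRealSubfield L)) L (IsCMField.complexConj L) 2 H).automorphicQuotient)
      [(adelicGroupData (↥(maximalRealSubfield L)) L (IsCMField.complexConj L) 2 H).IsAutomorphicMeasure μ]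
      {n' : ℕ} (e₁ : Fin 2 × Fin 1 ≃ Fin n')
      (lam : Literature.NumberTheory.Automorphic.IdeleClassGroup L →ₜ* Circle) (hlam : IsConjugateSymplectic L lam), HasWeight L lam 1 →
    ∀ (a : (↥(maximalRealSubfield L))ˣ) (χ : Chi (↥(maximalRealSubfield L)) L (IsCMField.complexConj L))
      (W : Type) [AddCommGroup W] [Module ℂ W]
      (σ : Representation ℂ (finAdelic (↥(maximalRealSubfield L)) L (IsCMField.complexConj L) 2 H) W),
      σ.IsIrreducible → σ.IsSmooth →
    ∀ j : σ.IntertwiningMap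
        ((rhoVAtLine (↥(maximalRealSubfield L)) L (IsCMField.complexConj L) 2 e₁ (Matrix.diagonal dV)
            (complexConj_imagUnit L) (imagUnit_ne_zero L) (imagUnit_mul_self L) (realDiagonal_isSymm L dV hdV)
            (isUnit_det_realDiagonal L dV hdV hdV0) (realDiagonal_map L dV hdV).symm
            (fun a => isCompatible_chiSplittingLine L e₁ dV hdV hdV0 (toHeckeCharacter L lam)
              (isUnitary_toHeckeCharacter L lam) ((isOscillatorChar_toHeckeCharacter_iff lam).mpr hlam)
              (TW (↥(maximalRealSubfield L)) a) (isSymm_TW (↥(maximalRealSubfield L)) a)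
              (isUnit_det_TW (↥(maximalRealSubfield L)) a) (JW (↥(maximalRealSubfield L)) L a)
              (JW_eq (↥(maximalRealSubfield L)) L a)) a χ).comp
          (finAdelicCongr (↥(maximalRealSubfield L)) L (IsCMField.complexConj L) g ht hg).symm.toMonoidHom),
      Function.Injective j →
    ∀ P : DiscreteAutomorphicRep (adelicGroupData (↥(maximalRealSubfield L)) L (IsCMField.complexConj L) 2 H) μ,
      P.IsAntiholCotangentAt₂ (IsCMField.complexConj_ne_one L) (UnitaryGroup.complexConj_smul_infinitePlace L) (cmPlace L ι) 𝔣 →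
      P.HasFinComponent σ →
      (∃ e : L, IsAdmissibleElement L hlam.cmType.1 e ∧
          epsOf (↥(maximalRealSubfield L)) (imagUnitSq L) L (2 * imagUnit L)⁻¹ e = locF (↥(maximalRealSubfield L)) (imagUnitSq L) a) →
      (cmPlace L ι).1.embedding ∉ hlam.cmType.1

/-- **Dominance (reviewer rule 5b): the E3nec₂ holomorphic letter is the restriction of the STRONGER biconditional tree letter
★ `curveThetaHodgeTypeSigned_hol` (E3₂)** — `Signed_hol → Necessity_hol`, keeping only the direction «adm → `e♮ ∈ Φ_λ`» of the
`iff`. [cite: Liu2021, App. D Rem. D.5 (p. 131)] -/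
theorem curveThetaHodgeTypeNecessity_hol_of_signed (h : curveThetaHodgeTypeSigned_hol) :
    curveThetaHodgeTypeNecessity_hol := by
  intro L _ _ _ ι H dV hdV hdV0 t ht g hg h1 h2 h3 𝔣 μ _ n' e₁ lam hlam hw a χ W _ _ σ hirr hsm j hj P hP hfin hadm
  exact (h L ι H dV hdV hdV0 t ht g hg h1 h2 h3 𝔣 μ e₁ lam hlam hw a χ W σ hirr hsm j hj P hP hfin).2 hadm

/-- **Dominance (reviewer rule 5b): the E3nec₂ antiholomorphic letter is the restriction of the STRONGER biconditional tree letter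
★ `curveThetaHodgeTypeSigned_antihol` (E3₂)** — `Signed_antihol → Necessity_antihol`, the contrapositive of the direction
«`e♮ ∈ Φ_λ` → ¬adm» of the `iff`. [cite: Liu2021, App. D Rem. D.5 (p. 131)] -/
theorem curveThetaHodgeTypeNecessity_antihol_of_signed (h : curveThetaHodgeTypeSigned_antihol) :
    curveThetaHodgeTypeNecessity_antihol := by
  intro L _ _ _ ι H dV hdV hdV0 t ht g hg h1 h2 h3 𝔣 μ _ n' e₁ lam hlam hw a χ W _ _ σ hirr hsm j hj P hP hfin hadm hmem
  exact (h L ι H dV hdV hdV0 t ht g hg h1 h2 h3 𝔣 μ e₁ lam hlam hw a χ W σ hirr hsm j hj P hP hfin).1 hmem hadm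

/-! ## EDITION 2 (ADD-ONLY; LEAD F0P6-plan (g3) «LD-R1» 03:05:24Z (R1), director s1186): #74R = the necessity letters RE-LETTERED WITH THEIR ORIENTATION

# [Liu2021, Rem. D.5] — E3nec RE-LETTERED WITH ITS ORIENTATION (#74R and its antiholomorphic twin): a `(1,0)`-type [resp. `(0,1)`-type] occurrence of
# `ω(λ, ε_a, χ)_f` with `ε_a` λ-admissible forces `e♮ ∈ Φ_λ` [resp. `e♮ ∉ Φ_λ`] — for `H = t⁻¹ · g* (diag dV) g` with `t` POSITIVE at the distinguished place `ι`

Topic `NumberTheory/Rogawski1990`; namespace `Literature.NumberTheory.Rogawski1990`.  TWO closed named facts `def … : Prop` (hol ∕ antihol; no `sorry`, no instance, no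
notation, no new carrier) + four DOMINANCE theorems.  WHY A RE-LETTER (cell `hodgecm-mathlib`, 2026-09-02): the letter ★ `curveThetaHodgeTypeNecessity_hol` (#74 of the floor-0
books, consumed by `Cruxes/HLiu418/Lines/F0_AlbCm` `stub_S1b_facts`) was RULED FALSE AS TYPED (LD2-p02 02:43:37Z, LD-ref1 ruling 02:53:24Z, director s1186 02:54:58Z):
it binds the scaling `t : L, t ≠ 0` of `hg : g* (t • H) g = diag dV` WITHOUT the orientation `0 < (ι t).re`, `(ι t).im = 0` that the crux's own shape statement
`S1BettiShape` (`F0_AlbCm.lean` :128, binders `_hτt _hτt'`) carries, while its conclusion (the Hodge type `(1,0)` read on the cone frame `𝔣 : ConeFrame L H (cmPlace L ι)`,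
★ `ConeFrame` ∕ `holCotForms₂` over `negCone (H.map e♮)`) is SIGN-SENSITIVE: under `(H, t) ↦ (−H, −t)` every hypothesis is preserved and «holomorphic» becomes
«antiholomorphic» (★ `Summits/…/Theorems/F0LD2ConeFlip.exists_isConeHol_flip`), and [Liu2021, Rem. D.5 «resp.»] with the companion triple of [Lem. D.1 (4)] then
produces data satisfying all hypotheses of #74 with the conclusion false (parity bookkeeping in LD-ref1's ruling).  Class MISSTATED: the repair is THIS letter = #74
token for token with the two binders `(hτt : 0 < (ι t).re) (hτt' : (ι t).im = 0)` inserted right after `(ht : t ≠ 0)`; with them `negCone (H♮) = negCone ((t • H)♮)` and the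
statement is [Liu2021, Rem. D.5] for Liu's hermitian space `V := t • H ≅ diag dV`.  #74 itself is NOT re-worded (it stays in the tree as a settled negative edge).

MATHEMATICAL CONTENT = that of #74 (see ★ `CurveThetaHodgeTypeNecessity`): [Liu2021, Rem. D.5, p. 131 L35–43] «for `π^∞ ≃ ω(μ, ε, χ)` endoscopic cohomological,
`m_cusp(π^{(1,0)}_∞ ⊗ π^∞) = 1` iff there is `e ∈ E^{×−}` with `ε_v = e·N(E_v^×)` at every finite `v`, `Im τ̃_i(e) < 0` for `i = 2, …, d` and `Im τ̃₁(e) < 0`» — ONLY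
the direction «occurs ∧ `ε_a` admissible ⇒ `e♮ ∈ Φ_λ`» (the one the crux consumes, ★ `F0AlbCmS1bSignedExclusion` :322), label-generic via [Liu2021, Lem. D.1 (4)]
(proof of Prop. D.4 (1), p. 131 L21–23: «exactly two adèlic oscillator triples … `τ₁ ∈ Φ_μ` determines exactly one of the two»); multiplicity side [Rogawski1990,
Prop. 11.1.1 (b), (d), Prop. 11.2.1 (b), Thm. 11.5.1 (b)], theta side [HarrisKudlaSweet1996, Thm. 6.1].  NO existence ∕ non-vanishing statement is asserted.
DOMINANCE (reviewer rule 5b): `…_hol_pos_of_hol` (the unsigned letter restricts to this one — a correct implication from a misstated fact, recorded for the books'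
monotonicity only) and `…_hol_pos_of_signed` (through ★ `curveThetaHodgeTypeNecessity_hol_of_signed`).  An IN-HOUSE proof modulo five named organ statements
(theta realisation at `λ`, theta finite component, the two-triples sentence, the archimedean sign at `ι` and the archimedean table away from `ι`) is the LD2 line of
the cell (`Cruxes/HLiu418/Lines`, skeleton `F0P6LD2StubS1bFacts`, head `curveThetaHodgeTypeNecessityHolPos_of_organs`).
WHY IT MIGHT FAIL: only through the remaining orientation conventions (`e♮ := (cmPlace L ι).1.embedding` vs `ι`, the sign of `δ_L = (2·imagUnit L)⁻¹`, `Φ_λ` vs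
`Φ̄_λ`) — the bit that killed #74 is now a binder.  HC_CM is proved only modulo the printed citations until rung 0 closes; this file discharges none of them.

## References
* [Liu2021] Y. Liu, *Fourier–Jacobi cycles and arithmetic relative trace formula*, Camb. J. Math. 9 (2021) = arXiv:2102.11518: Rem. D.5 (p. 131 L35–43), Prop. D.4 (1)
  and its proof (p. 130–131), Lem. D.1 (1), (4) (p. 125–126), Lem. D.2 (3) (p. 127–128), Def. 4.11 (p. 46), Def. 4.12 (p. 47).
* [Rogawski1990] J. Rogawski, *Automorphic representations of unitary groups in three variables*, Ann. of Math. Stud. 123 (1990), Ch. 11: Prop. 11.1.1 (b), (d);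
  Prop. 11.2.1 (b); Thm. 11.5.1 (b).
* [HarrisKudlaSweet1996] M. Harris, S. Kudla, W. J. Sweet, *Theta dichotomy for unitary groups*, J. AMS 9 (1996), Thm. 6.1.
-/

/-- **U** (E3nec₂-hol, ORIENTED: #74R) **[Liu2021, Rem. D.5], NECESSITY half, holomorphic occurrence, for `H = t⁻¹·g*(diag dV)g` WITH `0 < (ι t).re`, `(ι t).im = 0`:
a `(1,0)`-TYPE OCCURRENCE OF `ω(λ, ε_a, χ)_f` WITH `ε_a` λ-ADMISSIBLE FORCES `e♮ ∈ Φ_λ`**, `e♮ := (cmPlace L ι).1.embedding`.  Tokens = ★ `curveThetaHodgeTypeNecessity_hol`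
VERBATIM with the two orientation binders `(hτt : 0 < (ι t).re) (hτt' : (ι t).im = 0)` inserted after `(ht : t ≠ 0)` (the binders of the consumer `S1BettiShape`; without
them the letter is false in nature — module docstring).  READING: [Liu2021, Rem. D.5] third bullet «`τ̃₁(e)` has negative imaginary part» for the `(1,0)` case, for Liu's
`V := t • H` (positive-definite away from `ι`, signature `(1,1)` at `ι`), label-generic via [Liu2021, Lem. D.1 (4)] and the proof of Prop. D.4 (1).
[cite: Liu2021, App. D Rem. D.5 (p. 131); Prop. D.4 (1) and its proof (p. 130–131); Lem. D.1 (4); Def. 4.12]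
[cite: Rogawski1990, §11.1 Prop. 11.1.1 (b), (d); Prop. 11.2.1 (b); Thm. 11.5.1 (b)] [cite: HarrisKudlaSweet1996, Thm. 6.1] -/
def curveThetaHodgeTypeNecessity_hol_pos : Prop :=
  ∀ (L : Type) [Field L] [NumberField L] [IsCMField L] (ι : L →+* ℂ) (H : Matrix (Fin 2) (Fin 2) L)
    (dV : Fin 2 → L) (hdV : ∀ i, IsCMField.complexConj L (dV i) = dV i) (hdV0 : ∀ i, dV i ≠ 0)
    (t : L) (ht : t ≠ 0) (hτt : 0 < (ι t).re) (hτt' : (ι t).im = 0) (g : GL (Fin 2) L)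
    (hg : formCongr ((IsCMField.complexConj L : L ≃ₐ[↥(maximalRealSubfield L)] L) : L →+* L) g (t • H) = Matrix.diagonal dV),
    (∃ T : GL (Fin 2) ℂ, formCongr (starRingEnd ℂ) T ((Matrix.diagonal dV).map ι) = Matrix.diagonal ![(1 : ℂ), -1]) →
    (∀ τ' : L →+* ℂ, InfinitePlace.mk τ' ≠ InfinitePlace.mk ι → ((Matrix.diagonal dV).map τ').PosDef) →
    4 ≤ Module.finrank ℚ L →
    ∀ (𝔣 : ConeFrame L H (cmPlace L ι))
      (μ : Measure (adelicGroupData (↥(maximalRealSubfield L)) L (IsCMField.complexConj L) 2 H).automorphicQuotient)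
      [(adelicGroupData (↥(maximalRealSubfield L)) L (IsCMField.complexConj L) 2 H).IsAutomorphicMeasure μ]
      -- the ω-side data: reindexing, the LABEL `λ` (conjugate symplectic, weight one), line, central character
      {n' : ℕ} (e₁ : Fin 2 × Fin 1 ≃ Fin n')
      (lam : Literature.NumberTheory.Automorphic.IdeleClassGroup L →ₜ* Circle) (hlam : IsConjugateSymplectic L lam), HasWeight L lam 1 →
    ∀ (a : (↥(maximalRealSubfield L))ˣ) (χ : Chi (↥(maximalRealSubfield L)) L (IsCMField.complexConj L))
      (W : Type) [AddCommGroup W] [Module ℂ W]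
      (σ : Representation ℂ (finAdelic (↥(maximalRealSubfield L)) L (IsCMField.complexConj L) 2 H) W),
      σ.IsIrreducible → σ.IsSmooth →
    ∀ j : σ.IntertwiningMap
        ((rhoVAtLine (↥(maximalRealSubfield L)) L (IsCMField.complexConj L) 2 e₁ (Matrix.diagonal dV)
            (complexConj_imagUnit L) (imagUnit_ne_zero L) (imagUnit_mul_self L) (realDiagonal_isSymm L dV hdV)
            (isUnit_det_realDiagonal L dV hdV hdV0) (realDiagonal_map L dV hdV).symm
            (fun a => isCompatible_chiSplittingLine L e₁ dV hdV hdV0 (toHeckeCharacter L lam)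
              (isUnitary_toHeckeCharacter L lam) ((isOscillatorChar_toHeckeCharacter_iff lam).mpr hlam)
              (TW (↥(maximalRealSubfield L)) a) (isSymm_TW (↥(maximalRealSubfield L)) a)
              (isUnit_det_TW (↥(maximalRealSubfield L)) a) (JW (↥(maximalRealSubfield L)) L a)
              (JW_eq (↥(maximalRealSubfield L)) L a)) a χ).comp
          (finAdelicCongr (↥(maximalRealSubfield L)) L (IsCMField.complexConj L) g ht hg).symm.toMonoidHom),
      Function.Injective j →
    ∀ P : DiscreteAutomorphicRep (adelicGroupData (↥(maximalRealSubfield L)) L (IsCMField.complexConj L) 2 H) μ,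
      P.IsHolCotangentAt₂ (IsCMField.complexConj_ne_one L) (UnitaryGroup.complexConj_smul_infinitePlace L) (cmPlace L ι) 𝔣 →
      P.HasFinComponent σ →
      (∃ e : L, IsAdmissibleElement L hlam.cmType.1 e ∧
          epsOf (↥(maximalRealSubfield L)) (imagUnitSq L) L (2 * imagUnit L)⁻¹ e = locF (↥(maximalRealSubfield L)) (imagUnitSq L) a) →
      (cmPlace L ι).1.embedding ∈ hlam.cmType.1


/-- **U** (E3nec₂-antihol, ORIENTED: the antiholomorphic twin of #74R) **[Liu2021, Rem. D.5] «resp.», NECESSITY half, antiholomorphic occurrence, for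
`H = t⁻¹·g*(diag dV)g` WITH `0 < (ι t).re`, `(ι t).im = 0`: a `(0,1)`-TYPE OCCURRENCE OF `ω(λ, ε_a, χ)_f` WITH `ε_a` λ-ADMISSIBLE FORCES `e♮ ∉ Φ_λ`.**  Tokens =
★ `curveThetaHodgeTypeNecessity_antihol` VERBATIM with the same two binders inserted after `(ht : t ≠ 0)` (the unsigned twin falls with #74 under the same
flip).  Follows from `…_hol_pos` by complex conjugation and the conjugate partner `ω(λᶜ, ⟨−a⟩, χ̄)` exactly as ★ `E3Necessity.curveThetaHodgeTypeNecessity_antihol_of_hol`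
(the flip `(H, t)` is untouched by that argument; port = pass the two binders).
[cite: Liu2021, App. D Rem. D.5 (p. 131); Prop. D.4 (1) and its proof (p. 130–131); Lem. D.1 (2), (4); Def. 4.12]
[cite: Rogawski1990, §11.1 Prop. 11.1.1 (b), (d); Prop. 11.2.1 (b); Thm. 11.5.1 (b)] [cite: HarrisKudlaSweet1996, Thm. 6.1] -/
def curveThetaHodgeTypeNecessity_antihol_pos : Prop :=
  ∀ (L : Type) [Field L] [NumberField L] [IsCMField L] (ι : L →+* ℂ) (H : Matrix (Fin 2) (Fin 2) L)
    (dV : Fin 2 → L) (hdV : ∀ i, IsCMField.complexConj L (dV i) = dV i) (hdV0 : ∀ i, dV i ≠ 0)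
    (t : L) (ht : t ≠ 0) (hτt : 0 < (ι t).re) (hτt' : (ι t).im = 0) (g : GL (Fin 2) L)
    (hg : formCongr ((IsCMField.complexConj L : L ≃ₐ[↥(maximalRealSubfield L)] L) : L →+* L) g (t • H) = Matrix.diagonal dV),
    (∃ T : GL (Fin 2) ℂ, formCongr (starRingEnd ℂ) T ((Matrix.diagonal dV).map ι) = Matrix.diagonal ![(1 : ℂ), -1]) →
    (∀ τ' : L →+* ℂ, InfinitePlace.mk τ' ≠ InfinitePlace.mk ι → ((Matrix.diagonal dV).map τ').PosDef) →
    4 ≤ Module.finrank ℚ L →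
    ∀ (𝔣 : ConeFrame L H (cmPlace L ι))
      (μ : Measure (adelicGroupData (↥(maximalRealSubfield L)) L (IsCMField.complexConj L) 2 H).automorphicQuotient)
      [(adelicGroupData (↥(maximalRealSubfield L)) L (IsCMField.complexConj L) 2 H).IsAutomorphicMeasure μ]
      {n' : ℕ} (e₁ : Fin 2 × Fin 1 ≃ Fin n')
      (lam : Literature.NumberTheory.Automorphic.IdeleClassGroup L →ₜ* Circle) (hlam : IsConjugateSymplectic L lam), HasWeight L lam 1 →
    ∀ (a : (↥(maximalRealSubfield L))ˣ) (χ : Chi (↥(maximalRealSubfield L)) L (IsCMField.complexConj L))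
      (W : Type) [AddCommGroup W] [Module ℂ W]
      (σ : Representation ℂ (finAdelic (↥(maximalRealSubfield L)) L (IsCMField.complexConj L) 2 H) W),
      σ.IsIrreducible → σ.IsSmooth →
    ∀ j : σ.IntertwiningMap
        ((rhoVAtLine (↥(maximalRealSubfield L)) L (IsCMField.complexConj L) 2 e₁ (Matrix.diagonal dV)
            (complexConj_imagUnit L) (imagUnit_ne_zero L) (imagUnit_mul_self L) (realDiagonal_isSymm L dV hdV)
            (isUnit_det_realDiagonal L dV hdV hdV0) (realDiagonal_map L dV hdV).symm
            (fun a => isCompatible_chiSplittingLine L e₁ dV hdV hdV0 (toHeckeCharacter L lam)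
              (isUnitary_toHeckeCharacter L lam) ((isOscillatorChar_toHeckeCharacter_iff lam).mpr hlam)
              (TW (↥(maximalRealSubfield L)) a) (isSymm_TW (↥(maximalRealSubfield L)) a)
              (isUnit_det_TW (↥(maximalRealSubfield L)) a) (JW (↥(maximalRealSubfield L)) L a)
              (JW_eq (↥(maximalRealSubfield L)) L a)) a χ).comp
          (finAdelicCongr (↥(maximalRealSubfield L)) L (IsCMField.complexConj L) g ht hg).symm.toMonoidHom),
      Function.Injective j →
    ∀ P : DiscreteAutomorphicRep (adelicGroupData (↥(maximalRealSubfield L)) L (IsCMField.complexConj L) 2 H) μ,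
      P.IsAntiholCotangentAt₂ (IsCMField.complexConj_ne_one L) (UnitaryGroup.complexConj_smul_infinitePlace L) (cmPlace L ι) 𝔣 →
      P.HasFinComponent σ →
      (∃ e : L, IsAdmissibleElement L hlam.cmType.1 e ∧
          epsOf (↥(maximalRealSubfield L)) (imagUnitSq L) L (2 * imagUnit L)⁻¹ e = locF (↥(maximalRealSubfield L)) (imagUnitSq L) a) →
      (cmPlace L ι).1.embedding ∉ hlam.cmType.1

/-- DOMINANCE 1: the unsigned letter #74 (★ `curveThetaHodgeTypeNecessity_hol`, ruled misstated) restricts to the oriented one — drop the two binders.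
[cite: Liu2021, App. D Rem. D.5 (p. 131)] -/
theorem curveThetaHodgeTypeNecessity_hol_pos_of_hol (h : curveThetaHodgeTypeNecessity_hol) : curveThetaHodgeTypeNecessity_hol_pos := by
  intro L _ _ _ ι H dV hdV hdV0 t ht _ _ g hg
  exact h L ι H dV hdV hdV0 t ht g hg

/-- DOMINANCE 2: from the signed biconditional letter E3₂ ★ `curveThetaHodgeTypeSigned_hol`, through ★ `curveThetaHodgeTypeNecessity_hol_of_signed`.
[cite: Liu2021, App. D Rem. D.5 (p. 131); Lem. D.1 (4)] -/
theorem curveThetaHodgeTypeNecessity_hol_pos_of_signed (h : curveThetaHodgeTypeSigned_hol) : curveThetaHodgeTypeNecessity_hol_pos :=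
  curveThetaHodgeTypeNecessity_hol_pos_of_hol (curveThetaHodgeTypeNecessity_hol_of_signed h)

/-- DOMINANCE 3: the unsigned antihol letter (★ `curveThetaHodgeTypeNecessity_antihol`) restricts to the oriented one — drop the two binders.
[cite: Liu2021, App. D Rem. D.5 (p. 131)] -/
theorem curveThetaHodgeTypeNecessity_antihol_pos_of_antihol (h : curveThetaHodgeTypeNecessity_antihol) :
    curveThetaHodgeTypeNecessity_antihol_pos := by
  intro L _ _ _ ι H dV hdV hdV0 t ht _ _ g hg
  exact h L ι H dV hdV hdV0 t ht g hg

/-- DOMINANCE 4: from the signed biconditional letter E3₂ ★ `curveThetaHodgeTypeSigned_antihol`, through ★ `curveThetaHodgeTypeNecessity_antihol_of_signed`.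
[cite: Liu2021, App. D Rem. D.5 (p. 131); Lem. D.1 (4)] -/
theorem curveThetaHodgeTypeNecessity_antihol_pos_of_signed (h : curveThetaHodgeTypeSigned_antihol) : curveThetaHodgeTypeNecessity_antihol_pos :=
  curveThetaHodgeTypeNecessity_antihol_pos_of_antihol (curveThetaHodgeTypeNecessity_antihol_of_signed h)

end Literature.NumberTheory.Rogawski1990

end
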